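import Mathlib
import HarnessLib
import Literature.MathematicalPhysics.QuantumLattice.GrassmannEffectiveActionCopies
import Literature.MathematicalPhysics.QuantumLattice.SectorisedKernelNormRefinementPlateau
import Literature.MathematicalPhysics.QuantumLattice.SectorisedEffectiveActionBoundPlateau
import Summits.HubbardSuperconductivity.HubbardSuperconductivity.Theorems.KLProgrammeKLRegimeEngineTowerModelDefs
import Summits.HubbardSuperconductivity.HubbardSuperconductivity.Theorems.KLProgrammeKLRegimeTwoVolumeTowerSpineDefs
import Summits.HubbardSuperconductivity.HubbardSuperconductivity.Theorems.KLProgrammeKLRegimeTwoVolumeGluedProfiles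

/-!
# Route `KLProgramme` — crux K3 ENGINE (stmt-HubbardSuperconductivity-20437), stub (e) proof-input «(e)-D-ROWS», (M1)/F-D3′: THE OBJECTS OF THE
# TWO-VOLUME LIPSCHITZ TOWER in E1's block vocabulary (definitions; seat hubbard-kl-k3c4-p1 g23; `--supports` 20437; DROWS-SCOPE-g22 §7.2, §8, §8.1)

The two-volume (Lipschitz) tower compares the blocked scale flow (`…EngineTowerModelDefs`: block length `d`, boundaries `J_k = d·k`, input `𝒱_{dk}[K]` of block `k`,
increment `Δ_k`) of a FINE torus `b·L` with that of the COARSE torus `L`, both at the COMMON frame `K`, in the POSITION × SECTOR labels on which the zone/deep-pin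
doors act (`Lit/GrassmannDeepPin{GradedLipschitz,Binomial}`, `…TwoVolumeLipDeepStep`, `…TwoVolumeLipDeepFirstOrder`).  This file only NAMES the objects:

* §0 `klLabelWt wt` — a position tree weight pulled back to labels along `latticeLegPos` (E1's `klScaleWt … ((univ.image X).image latticeLegPos)` is
  `klLabelWt (klScaleWt …) (univ.image X)`, `rfl`); `isTreeWeight_klLabelWt`.
* §1 ONE volume `V`: the input in the SECTOR-FIELD representation **`klLipInput V M β U μ K d k := sectorPreimage β F_{dk−1} 𝒱_{V,dk}[K]`** (labels
  `SpaceTimeIdx V M × SectorLeg (sectorCount (dk−1))`, E1's measuring family of the input of block `k`; `= map (toLin' (ε•E_V(F_{dk−1}))) 𝒱_{dk}`,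
  `sectorPreimage_eq_map_smul_sectorAnalysis` — the object of the plateau doors `Lit/SectorisedEffectiveActionBound{,Plateau}`, so `map (toLin' S(F̃)) · = 𝒱_{dk}`
  on the plateau by `map_sectorSub_sectorPreimage`; meaningful for `dk ≥ 1`, as E1's `klTowerMeasWt` — at `dk = 0` the family index is the junk value
  `0 − 1 = 0`) and the born increment **`klLipBorn V M β U μ K d k := sectorPreimage β F_{dk} Δ_{V,k}`** (E1's born family);
  the fields carry `ε = imagTimeWeight β M`, so weighted pinned sums of the kernels are `ε ×` E1's `ε^{m−1}`-currency:
  `sum_wt_norm_kernel_klLipInput_eq/_le` (`= ε·klWtPinnedSumOf … ≤ ε·klTowerMeasWt …`), `sum_wt_norm_kernel_klLipBorn_eq/_le` (`≤ ε·klTowerBornWt …`) — the (M2)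
  majorant rows of the deep-pin doors in E1's sizes; `kernel_map_toLin'_smul`; parity / constant part rows.
* §2 the BLOCK GLUE over the canonical block structure `klBlockEquiv L b M N` (`…TwoVolumeTowerSpineDefs`): the block embedding **`klBlockEmb L b M N β`** (the
  `LinearMap.pi` witness of `Lit/GrassmannEffectiveActionCopies.blockEmb_pi_apply`), the glue **`klGlue L b M N W := Σ_β map (klBlockEmb … β) W`**, the copies covariance
  **`klCopiesCov L b M N C`**; rows: `klBlockEmb_apply` (the defining property every copies lemma takes), `klCopiesCov_apply`, `kernel_klGlue` (glued kernels live in one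
  block), `sum_pinned_norm_kernel_klGlue_eq` (pinned profiles of the glue = those of one copy), `klGlue_mem_evenOdd_zero`, `constPart_klGlue`.
The two-volume DIFFERENCES (`klLipInputDiff`, `klLipBornDiff`), the depth sets `klDeepPins` and the deep-pin suprema are the sequel `…TwoVolumeLipDiffDefs`.

Definitions with bodies and `rfl`/order rows only; nothing about the model is asserted; nothing asserts the (D) rows, stub (e), VL, K3 or superconductivity.
References: BGM 2006 §2.7 (2.70)–(2.71), §2.8, §3 (3.2)–(3.8) [cite: BenfattoGiulianiMastropietro2006]; Salmhofer 1999 Def. 2.19 (2.102)–(2.106).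
-/

noncomputable section

namespace Summit.HubbardSuperconductivity.HubbardSuperconductivity.Theorems.TwoVolumeLip

set_option linter.dupNamespace false -- summit = problem name (single-conjunct summit), D-0017

open Finset Literature.MathematicalPhysics.QuantumLattice GrassmannAlgebra Literature.Probability.LatticeModels
  Literature.Probability.LatticeModels.BattleFederbush
open Literature.MathematicalPhysics.QuantumLattice.FermiRG
open Summit.HubbardSuperconductivity.HubbardSuperconductivity.Theorems.KLRegimeSplit
open Summit.HubbardSuperconductivity.HubbardSuperconductivity.Theorems.KLProgrammeLegKernels
open Summit.HubbardSuperconductivity.HubbardSuperconductivity.Theorems.DispersionFlow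
open Summit.HubbardSuperconductivity.HubbardSuperconductivity.Theorems.EngineV8
open Summit.HubbardSuperconductivity.HubbardSuperconductivity.Theorems.TwoVolumeSource
open Summit.HubbardSuperconductivity.HubbardSuperconductivity.Theorems.TwoVolumeDefect

/-! ## §0 Position tree weights pulled back to labels -/

section LabelWt

variable {V M N : ℕ}

/-- **`klLabelWt wt`** — a weight on position sets (grid time × torus site) read on sets of sector-field labels through `latticeLegPos`:
`klLabelWt wt S = wt (S.image latticeLegPos)`. -/
def klLabelWt (wt : Finset (ZMod (2 * (2 * M)) × TorusSite 2 V) → ℝ) (S : Finset (SpaceTimeIdx V M × SectorLeg N)) : ℝ :=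
  wt (S.image (latticeLegPos (2 * (2 * M))))

/-- Unfolding `klLabelWt`. -/
theorem klLabelWt_apply (wt : Finset (ZMod (2 * (2 * M)) × TorusSite 2 V) → ℝ) (S : Finset (SpaceTimeIdx V M × SectorLeg N)) :
    klLabelWt wt S = wt (S.image (latticeLegPos (2 * (2 * M)))) := rfl

/-- The pull-back of a tree weight is a tree weight (`IsTreeWeight.comap`). -/
theorem isTreeWeight_klLabelWt {wt : Finset (ZMod (2 * (2 * M)) × TorusSite 2 V) → ℝ} (hwt : IsTreeWeight wt) :
    IsTreeWeight (klLabelWt (N := N) wt) :=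
  hwt.comap (latticeLegPos (2 * (2 * M)))

/-- E1's scale weight `klScaleWt V M β J` read on labels is a tree weight (`0 ≤ β`). -/
theorem isTreeWeight_klLabelWt_klScaleWt [NeZero V] [NeZero M] {β : ℝ} (hβ : 0 ≤ β) (J : ℕ) :
    IsTreeWeight (klLabelWt (N := N) (klScaleWt V M β J)) :=
  isTreeWeight_klLabelWt (isTreeWeight_klScaleWt V M hβ J)

end LabelWt

/-! ## §1 One volume: the analysed block input and the analysed born increment -/

section Scaling

variable {Γ Γ' : Type*} [Fintype Γ] [DecidableEq Γ]

/-- **Kernels under a scaled substitution**: `kernel (map (toLin' (c • A)) T) m X′ = c^m · kernel (map (toLin' A) T) m X′`. -/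
theorem kernel_map_toLin'_smul (c : ℂ) (A : Matrix Γ' Γ ℂ) (T : GrassmannAlgebra ℂ Γ) (m : ℕ) (X' : Fin m → Γ') :
    kernel ℂ (ExteriorAlgebra.map (Matrix.toLin' (c • A)) T) m X' = c ^ m * kernel ℂ (ExteriorAlgebra.map (Matrix.toLin' A) T) m X' := by
  rw [kernel_map, kernel_map, mul_sum]
  refine sum_congr rfl fun X _ => ?_
  simp only [LinearMap.toMatrix'_toLin', Matrix.smul_apply, smul_eq_mul]
  rw [prod_mul_distrib, prod_const, card_univ, Fintype.card_fin, mul_assoc]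

/-- Norm form for a nonnegative real scale: `‖kernel (map (toLin' (c • A)) T) m X′‖ = c^m · ‖kernel (map (toLin' A) T) m X′‖`. -/
theorem norm_kernel_map_toLin'_smul {c : ℝ} (hc : 0 ≤ c) (A : Matrix Γ' Γ ℂ) (T : GrassmannAlgebra ℂ Γ) (m : ℕ) (X' : Fin m → Γ') :
    ‖kernel ℂ (ExteriorAlgebra.map (Matrix.toLin' (((c : ℝ) : ℂ) • A)) T) m X'‖ =
      c ^ m * ‖kernel ℂ (ExteriorAlgebra.map (Matrix.toLin' A) T) m X'‖ := by
  rw [kernel_map_toLin'_smul, norm_mul, norm_pow, Complex.norm_real, Real.norm_of_nonneg hc]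

end Scaling

/-- **The sector preimage IS the `ε`-scaled analysed polynomial**: `sectorPreimage β F G = map (toLin' (ε • E(F))) G` (both are presented by the
kernels `ε^m · W_{F,m}`, `kernel_sectorPreimage_eq_sectorisedKernel` / `kernel_map_sectorAnalysis`). -/
theorem sectorPreimage_eq_map_smul_sectorAnalysis {V M N : ℕ} [NeZero V] (β : ℝ) (F : Fin N → FreqMomentum V M → ℂ) (G : HubbardGrassmann V M) :
    sectorPreimage β F G = ExteriorAlgebra.map (Matrix.toLin' ((((imagTimeWeight β M : ℝ) : ℂ)) • sectorAnalysisMatrix V M β F)) G := by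
  rw [eq_sum_presented_kernel ℂ (sectorPreimage β F G),
    eq_sum_presented_kernel ℂ (ExteriorAlgebra.map (Matrix.toLin' ((((imagTimeWeight β M : ℝ) : ℂ)) • sectorAnalysisMatrix V M β F)) G)]
  refine sum_congr rfl fun m _ => ?_
  congr 1
  funext Y
  rw [kernel_sectorPreimage_eq_sectorisedKernel, kernel_map_toLin'_smul, kernel_map_sectorAnalysis]

section OneVolume

variable (V M : ℕ) [NeZero V]

/-- **`klLipInput V M β U μ K d k`** — the input `𝒱_{dk}[K]` of block `k` in the SECTOR-FIELD representation of its measuring family `F_{dk−1}`: the sector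
preimage `sectorPreimage β F_{dk−1} 𝒱_{dk}[K]` of the plateau doors (`Lit/SectorisedEffectiveActionBound{,Plateau}`: `map (toLin' S(F̃)) · = 𝒱_{dk}` on the
plateau, kernels `ε^m W_{F,m}` = those of `map (toLin' (ε • E(F_{dk−1}))) 𝒱_{dk}`, `klLipInput_eq_map`), on the labels `SpaceTimeIdx V M × SectorLeg (sectorCount (dk−1))`. -/
def klLipInput (β U μ : ℝ) (K : TrigPolyC4v) (d k : ℕ) : GrassmannAlgebra ℂ (SpaceTimeIdx V M × SectorLeg (sectorCount (d * k - 1))) :=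
  sectorPreimage β (klAnisoFamily V M β μ K klE0 (d * k - 1)) (klTowerInput V M β U μ K d k)

/-- **`klLipBorn V M β U μ K d k`** — the born increment `Δ_k` of block `k` in the sector-field representation of its born family `F_{dk}`:
`sectorPreimage β F_{dk} Δ_k` on the labels `SpaceTimeIdx V M × SectorLeg (sectorCount (dk))`. -/
def klLipBorn (β U μ : ℝ) (K : TrigPolyC4v) (d k : ℕ) : GrassmannAlgebra ℂ (SpaceTimeIdx V M × SectorLeg (sectorCount (d * k))) :=
  sectorPreimage β (klAnisoFamily V M β μ K klE0 (d * k)) (klTowerIncr V M β U μ K d k)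

variable {V M}

/-- Unfolding `klLipInput`. -/
theorem klLipInput_def (β U μ : ℝ) (K : TrigPolyC4v) (d k : ℕ) :
    klLipInput V M β U μ K d k = sectorPreimage β (klAnisoFamily V M β μ K klE0 (d * k - 1)) (klTowerInput V M β U μ K d k) := rfl

/-- Unfolding `klLipBorn`. -/
theorem klLipBorn_def (β U μ : ℝ) (K : TrigPolyC4v) (d k : ℕ) :
    klLipBorn V M β U μ K d k = sectorPreimage β (klAnisoFamily V M β μ K klE0 (d * k)) (klTowerIncr V M β U μ K d k) := rfl

/-- `klLipInput` as the `ε`-scaled analysed input (the convention of `…TwoVolumeTowerDefs.klTowerD` / `…TwoVolumeSrcBlockIdentity`). -/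
theorem klLipInput_eq_map (β U μ : ℝ) (K : TrigPolyC4v) (d k : ℕ) :
    klLipInput V M β U μ K d k =
      ExteriorAlgebra.map (Matrix.toLin' ((((imagTimeWeight β M : ℝ) : ℂ)) •
        sectorAnalysisMatrix V M β (klAnisoFamily V M β μ K klE0 (d * k - 1)))) (klTowerInput V M β U μ K d k) :=
  sectorPreimage_eq_map_smul_sectorAnalysis β _ _

/-- `klLipBorn` as the `ε`-scaled analysed increment. -/
theorem klLipBorn_eq_map (β U μ : ℝ) (K : TrigPolyC4v) (d k : ℕ) :
    klLipBorn V M β U μ K d k =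
      ExteriorAlgebra.map (Matrix.toLin' ((((imagTimeWeight β M : ℝ) : ℂ)) •
        sectorAnalysisMatrix V M β (klAnisoFamily V M β μ K klE0 (d * k)))) (klTowerIncr V M β U μ K d k) :=
  sectorPreimage_eq_map_smul_sectorAnalysis β _ _

/-- The kernels of `klLipInput` are `ε^m ×` the kernels of the plainly analysed input (`0 ≤ β`). -/
theorem norm_kernel_klLipInput_eq {β : ℝ} (hβ : 0 ≤ β) (U μ : ℝ) (K : TrigPolyC4v) (d k m : ℕ)
    (X : Fin m → SpaceTimeIdx V M × SectorLeg (sectorCount (d * k - 1))) :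
    ‖kernel ℂ (klLipInput V M β U μ K d k) m X‖ = imagTimeWeight β M ^ m *
      ‖kernel ℂ (ExteriorAlgebra.map (Matrix.toLin' (sectorAnalysisMatrix V M β (klAnisoFamily V M β μ K klE0 (d * k - 1))))
        (klTowerInput V M β U μ K d k)) m X‖ := by
  rw [klLipInput_eq_map]
  exact norm_kernel_map_toLin'_smul (imagTimeWeight_nonneg hβ M) _ _ m X

/-- The kernels of `klLipBorn` are `ε^m ×` the kernels of the plainly analysed increment (`0 ≤ β`). -/
theorem norm_kernel_klLipBorn_eq {β : ℝ} (hβ : 0 ≤ β) (U μ : ℝ) (K : TrigPolyC4v) (d k m : ℕ)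
    (X : Fin m → SpaceTimeIdx V M × SectorLeg (sectorCount (d * k))) :
    ‖kernel ℂ (klLipBorn V M β U μ K d k) m X‖ = imagTimeWeight β M ^ m *
      ‖kernel ℂ (ExteriorAlgebra.map (Matrix.toLin' (sectorAnalysisMatrix V M β (klAnisoFamily V M β μ K klE0 (d * k))))
        (klTowerIncr V M β U μ K d k)) m X‖ := by
  rw [klLipBorn_eq_map]
  exact norm_kernel_map_toLin'_smul (imagTimeWeight_nonneg hβ M) _ _ m X

/-- **The `klScaleWt`-weighted pinned sum of `klLipInput` IS `ε ×` E1's measured weighted pinned sum of the input of block `k`** (`0 ≤ β`):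
`Σ_{X : X_q = w} klLabelWt (klScaleWt … (dk−1)) (im X) · ‖kernel (klLipInput …) m X‖ = ε · klWtPinnedSumOf … (dk−1) m 𝒱_{dk} q w`. -/
theorem sum_wt_norm_kernel_klLipInput_eq {β : ℝ} (hβ : 0 ≤ β) (U μ : ℝ) (K : TrigPolyC4v) (d k : ℕ) {m : ℕ} (q : Fin m)
    (w : SpaceTimeIdx V M × SectorLeg (sectorCount (d * k - 1))) :
    ∑ X ∈ univ.filter (fun X : Fin m → SpaceTimeIdx V M × SectorLeg (sectorCount (d * k - 1)) => X q = w),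
        klLabelWt (klScaleWt V M β (d * k - 1)) (univ.image X) * ‖kernel ℂ (klLipInput V M β U μ K d k) m X‖ =
      imagTimeWeight β M * klWtPinnedSumOf V M β μ K (d * k - 1) m (klTowerInput V M β U μ K d k) q w := by
  obtain ⟨n, rfl⟩ : ∃ n, m = n + 1 := ⟨m - 1, by have := q.pos; omega⟩
  unfold klWtPinnedSumOf
  rw [Nat.add_sub_cancel, ← mul_assoc, ← pow_succ', mul_sum]
  refine sum_congr rfl fun X _ => ?_
  rw [norm_kernel_klLipInput_eq hβ, klLabelWt_apply]
  ring

/-- **The `klScaleWt`-weighted pinned sum of `klLipBorn` IS `ε ×` E1's born weighted pinned sum of block `k`** (`0 ≤ β`). -/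
theorem sum_wt_norm_kernel_klLipBorn_eq {β : ℝ} (hβ : 0 ≤ β) (U μ : ℝ) (K : TrigPolyC4v) (d k : ℕ) {m : ℕ} (q : Fin m)
    (w : SpaceTimeIdx V M × SectorLeg (sectorCount (d * k))) :
    ∑ X ∈ univ.filter (fun X : Fin m → SpaceTimeIdx V M × SectorLeg (sectorCount (d * k)) => X q = w),
        klLabelWt (klScaleWt V M β (d * k)) (univ.image X) * ‖kernel ℂ (klLipBorn V M β U μ K d k) m X‖ =
      imagTimeWeight β M * klWtPinnedSumOf V M β μ K (d * k) m (klTowerIncr V M β U μ K d k) q w := by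
  obtain ⟨n, rfl⟩ : ∃ n, m = n + 1 := ⟨m - 1, by have := q.pos; omega⟩
  unfold klWtPinnedSumOf
  rw [Nat.add_sub_cancel, ← mul_assoc, ← pow_succ', mul_sum]
  refine sum_congr rfl fun X _ => ?_
  rw [norm_kernel_klLipBorn_eq hβ, klLabelWt_apply]
  ring

/-- Hence E1's sizes bound the weighted pinned sums: `… ≤ ε · klTowerMeasWt … d k m` (input) -/
theorem sum_wt_norm_kernel_klLipInput_le {β : ℝ} (hβ : 0 ≤ β) (U μ : ℝ) (K : TrigPolyC4v) (d k : ℕ) {m : ℕ} (q : Fin m)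
    (w : SpaceTimeIdx V M × SectorLeg (sectorCount (d * k - 1))) :
    ∑ X ∈ univ.filter (fun X : Fin m → SpaceTimeIdx V M × SectorLeg (sectorCount (d * k - 1)) => X q = w),
        klLabelWt (klScaleWt V M β (d * k - 1)) (univ.image X) * ‖kernel ℂ (klLipInput V M β U μ K d k) m X‖ ≤
      imagTimeWeight β M * klTowerMeasWt V M β U μ K d k m := by
  rw [sum_wt_norm_kernel_klLipInput_eq hβ]
  exact mul_le_mul_of_nonneg_left (klWtPinnedSumOf_le_klTowerMeasWt β U μ K d k m q w) (imagTimeWeight_nonneg hβ M)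

/-- and `… ≤ ε · klTowerBornWt … d k m` (born). -/
theorem sum_wt_norm_kernel_klLipBorn_le {β : ℝ} (hβ : 0 ≤ β) (U μ : ℝ) (K : TrigPolyC4v) (d k : ℕ) {m : ℕ} (q : Fin m)
    (w : SpaceTimeIdx V M × SectorLeg (sectorCount (d * k))) :
    ∑ X ∈ univ.filter (fun X : Fin m → SpaceTimeIdx V M × SectorLeg (sectorCount (d * k)) => X q = w),
        klLabelWt (klScaleWt V M β (d * k)) (univ.image X) * ‖kernel ℂ (klLipBorn V M β U μ K d k) m X‖ ≤
      imagTimeWeight β M * klTowerBornWt V M β U μ K d k m := by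
  rw [sum_wt_norm_kernel_klLipBorn_eq hβ]
  exact mul_le_mul_of_nonneg_left (klWtPinnedSumOf_le_klTowerBornWt β U μ K d k m q w) (imagTimeWeight_nonneg hβ M)

/-- The analysed input is even when the input is. -/
theorem klLipInput_mem_evenOdd_zero {β U μ : ℝ} {K : TrigPolyC4v} {d k : ℕ} (h : klTowerInput V M β U μ K d k ∈ evenOdd ℂ 0) :
    klLipInput V M β U μ K d k ∈ evenOdd ℂ 0 :=
  sectorPreimage_mem_evenPart β _ h

/-- The analysed born increment is even when the increment is. -/
theorem klLipBorn_mem_evenOdd_zero {β U μ : ℝ} {K : TrigPolyC4v} {d k : ℕ} (h : klTowerIncr V M β U μ K d k ∈ evenOdd ℂ 0) :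
    klLipBorn V M β U μ K d k ∈ evenOdd ℂ 0 :=
  sectorPreimage_mem_evenPart β _ h

/-- The constant part of the analysed input is that of the input. -/
theorem constPart_klLipInput (β U μ : ℝ) (K : TrigPolyC4v) (d k : ℕ) :
    constPart ℂ (klLipInput V M β U μ K d k) = constPart ℂ (klTowerInput V M β U μ K d k) :=
  constPart_sectorPreimage β _ _

/-- The constant part of the analysed born increment is that of the increment. -/
theorem constPart_klLipBorn (β U μ : ℝ) (K : TrigPolyC4v) (d k : ℕ) :
    constPart ℂ (klLipBorn V M β U μ K d k) = constPart ℂ (klTowerIncr V M β U μ K d k) :=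
  constPart_sectorPreimage β _ _

end OneVolume

/-! ## §2 The block glue over the canonical block structure -/

section Glue

variable (L b M N : ℕ) [NeZero L] [NeZero (b * L)]

/-- **`klBlockEmb L b M N β`** — the embedding of block `β` of the canonical block structure `klBlockEquiv L b M N`: the substitution of generators
`(klBlockEmb … β v) X′ = [blk X′ = β] · v (res X′)` (the `LinearMap.pi` witness of `Lit/GrassmannEffectiveActionCopies`). -/
def klBlockEmb (β : Fin 2 → Fin b) : (SpaceTimeIdx L M × SectorLeg N → ℂ) →ₗ[ℂ] (SpaceTimeIdx (b * L) M × SectorLeg N → ℂ) :=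
  LinearMap.pi fun X' : SpaceTimeIdx (b * L) M × SectorLeg N =>
    if (klBlockEquiv L b M N X').1 = β then (LinearMap.proj (klBlockEquiv L b M N X').2 : (SpaceTimeIdx L M × SectorLeg N → ℂ) →ₗ[ℂ] ℂ) else 0

/-- **`klGlue L b M N W`** — the GLUED coarse element on the fine labels: one embedded copy of `W` per block, `Σ_β map (klBlockEmb … β) W`. -/
def klGlue (W : GrassmannAlgebra ℂ (SpaceTimeIdx L M × SectorLeg N)) : GrassmannAlgebra ℂ (SpaceTimeIdx (b * L) M × SectorLeg N) :=
  ∑ β : Fin 2 → Fin b, ExteriorAlgebra.map (klBlockEmb L b M N β) W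

/-- **`klCopiesCov L b M N C`** — the COPIES covariance on the fine labels of a covariance `C` on the coarse labels: one independent copy per block,
`C′(X′, Y′) = [blk X′ = blk Y′] · C (res X′) (res Y′)`. -/
def klCopiesCov (C : Matrix (SpaceTimeIdx L M × SectorLeg N) (SpaceTimeIdx L M × SectorLeg N) ℂ) :
    Matrix (SpaceTimeIdx (b * L) M × SectorLeg N) (SpaceTimeIdx (b * L) M × SectorLeg N) ℂ :=
  Matrix.of fun X' Y' => if (klBlockEquiv L b M N X').1 = (klBlockEquiv L b M N Y').1 then
    C (klBlockEquiv L b M N X').2 (klBlockEquiv L b M N Y').2 else 0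

variable {L b M N}

/-- **The defining property of the block embedding** (the hypothesis `hF`/`hf` of every lemma of `Lit/GrassmannEffectiveActionCopies`,
`…TwoVolumeGluedProfiles`, `…TwoVolumeSubstitutionGluing*`). -/
theorem klBlockEmb_apply (β : Fin 2 → Fin b) (v : SpaceTimeIdx L M × SectorLeg N → ℂ) (X' : SpaceTimeIdx (b * L) M × SectorLeg N) :
    klBlockEmb L b M N β v X' = if (klBlockEquiv L b M N X').1 = β then v (klBlockEquiv L b M N X').2 else 0 :=
  blockEmb_pi_apply ℂ (klBlockEquiv L b M N) β v X'

/-- Unfolding `klGlue`. -/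
theorem klGlue_def (W : GrassmannAlgebra ℂ (SpaceTimeIdx L M × SectorLeg N)) :
    klGlue L b M N W = ∑ β : Fin 2 → Fin b, ExteriorAlgebra.map (klBlockEmb L b M N β) W := rfl

/-- Unfolding `klCopiesCov` (the hypothesis `hC'` of the copies lemmas). -/
theorem klCopiesCov_apply (C : Matrix (SpaceTimeIdx L M × SectorLeg N) (SpaceTimeIdx L M × SectorLeg N) ℂ)
    (X' Y' : SpaceTimeIdx (b * L) M × SectorLeg N) :
    klCopiesCov L b M N C X' Y' = if (klBlockEquiv L b M N X').1 = (klBlockEquiv L b M N Y').1 then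
      C (klBlockEquiv L b M N X').2 (klBlockEquiv L b M N Y').2 else 0 := rfl

/-- The glue is additive. -/
theorem klGlue_add (W W' : GrassmannAlgebra ℂ (SpaceTimeIdx L M × SectorLeg N)) :
    klGlue L b M N (W + W') = klGlue L b M N W + klGlue L b M N W' := by
  simp only [klGlue, map_add, sum_add_distrib]

/-- The glue of a difference. -/
theorem klGlue_sub (W W' : GrassmannAlgebra ℂ (SpaceTimeIdx L M × SectorLeg N)) :
    klGlue L b M N (W - W') = klGlue L b M N W - klGlue L b M N W' := by
  simp only [klGlue, map_sub, sum_sub_distrib]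

/-- **Kernels of the glued element live in one block**: `kernel (klGlue W) m X′ = [all legs of X′ in the block of X′_j] · kernel W m (res ∘ X′)`. -/
theorem kernel_klGlue (W : GrassmannAlgebra ℂ (SpaceTimeIdx L M × SectorLeg N)) {m : ℕ} (j : Fin m)
    (X' : Fin m → SpaceTimeIdx (b * L) M × SectorLeg N) :
    kernel ℂ (klGlue L b M N W) m X' =
      if ∀ i, (klBlockEquiv L b M N (X' i)).1 = (klBlockEquiv L b M N (X' j)).1 then
        kernel ℂ W m (fun i => (klBlockEquiv L b M N (X' i)).2) else 0 :=
  kernel_copies_sum (klBlockEquiv L b M N) (klBlockEmb L b M N) (klBlockEmb_apply) W j X'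

/-- **The unweighted pinned profile of the glued element at a fine pin is that of `W` at the residue pin.** -/
theorem sum_pinned_norm_kernel_klGlue_eq (W : GrassmannAlgebra ℂ (SpaceTimeIdx L M × SectorLeg N)) {m : ℕ} (j : Fin m)
    (x' : SpaceTimeIdx (b * L) M × SectorLeg N) :
    ∑ Y' ∈ univ.filter (fun Y' : Fin m → SpaceTimeIdx (b * L) M × SectorLeg N => Y' j = x'), ‖kernel ℂ (klGlue L b M N W) m Y'‖ =
      ∑ Y ∈ univ.filter (fun Y : Fin m → SpaceTimeIdx L M × SectorLeg N => Y j = (klBlockEquiv L b M N x').2), ‖kernel ℂ W m Y‖ :=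
  sum_pinned_norm_kernel_glue_eq (klBlockEquiv L b M N) (klBlockEmb L b M N) klBlockEmb_apply W j x'

/-- The glue of an even element is even. -/
theorem klGlue_mem_evenOdd_zero {W : GrassmannAlgebra ℂ (SpaceTimeIdx L M × SectorLeg N)} (hW : W ∈ evenOdd ℂ 0) :
    klGlue L b M N W ∈ evenOdd ℂ 0 :=
  Submodule.sum_mem _ fun β _ => map_mem_evenOdd_zero ℂ (klBlockEmb L b M N β) hW

/-- The constant part of the glue of an element without constant part vanishes. -/
theorem constPart_klGlue {W : GrassmannAlgebra ℂ (SpaceTimeIdx L M × SectorLeg N)} (hW : constPart ℂ W = 0) :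
    constPart ℂ (klGlue L b M N W) = 0 := by
  rw [klGlue, map_sum]
  exact sum_eq_zero fun β _ => by rw [constPart_map, hW]

end Glue

end Summit.HubbardSuperconductivity.HubbardSuperconductivity.Theorems.TwoVolumeLip

end
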